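import Summits.PneNP.PneNP.Theorems.ClusUniversalCertificateSkewKappaLeCodim
import Mathlib
import HarnessLib

/-!
# Route ClusUniversalCertificate — line `layer` on the crux `UniversalCertAll` (stmt-PneNP-19683): the objects
(rung F-N1, cell pnp-ideate, planner p1 g6; registered skeleton HOME/pnp-ideate-p1/lines/layer.lean, v2 sha16 cfd997240e04,
card lines/layer.md; stubs `stub_ucLeTwo` (M–L) and `stub_layerStep` (M) WANTED for an idle prover on STATUS 07:19Z)

The objects of p1's line `layer` VERBATIM (`dimSum`, `UCIneq`, `IsLayerFamily`, `LayerIneq`, `LayerLemmaFrom3`, `UCLeTwo`,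
`LayerStepAll`; the skeleton declares them in `Summit.PneNP.PneNP.Cruxes.UniversalCertAll.Layer`, here under the Theorems namespace
`…Theorems.ClusLayer` with the same short names and bodies; `codimY` is the landed `…Theorems.ClusSkew.codimY` of
`ClusUniversalCertificateSkewKappaLeCodim.lean` (p494524), whose body is the route file's certificate codimension verbatim), and the
skeleton's induction on the number of blocks `ucIneq_all` (stubs ⟹ the certificate for every `(n, m, Y)`), sorry-free.

ONE-BLOCK INDUCTION VIA LAYER FAMILIES (p1's line card): write `D(S) := Σ_{x∈S} dim_S(x)`; the crux for `Y ⊆ (𝔽₂^m)^n` reads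
`D(Y) ≤ n(m−1)|Y| + 2^m·ZE(Y)`.  For a block `k` of `Y ⊆ (𝔽₂^m)^{n+1}` a LAYER FAMILY is a list `L` of subsets of `(𝔽₂^m)^n` with
`Σ_{S∈L} 1_S =` the fibre multiplicity of `Y` over block `k`; bookkeeping (`LayerStepAll`) plus the LAYER INEQUALITY
`D(Y) ≤ Σ_{S∈L} D(S) + (m−1)|Y| + 2^m·#{y ∈ Y : y_k = 0}` (`LayerLemmaFrom3`, the load-bearing conjecture, from three blocks on) give
the certificate by induction from the base of at most two blocks (`UCLeTwo`, proved in `ClusUniversalCertificateLayerUCLeTwo.lean`).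

This file is ROUTE-INDEPENDENT (no `Theses` import, per the referee's theses-cone relay of 2026-08-27T07:40Z): the composition with the
route decl `…Theses.ClusUniversalCertificate.UniversalCertAll` is the registered skeleton's `UniversalCertAll_of` and is not repeated here.

HONEST FRAMING: objects + a sorry-free composition for an OPEN crux of route ClusUniversalCertificate; the load-bearing stub
`stub_layerLemma3 : LayerLemmaFrom3` is OPEN and XL; FRONTIER rung F-N1 — nothing here bears on P vs NP.
-/

set_option linter.dupNamespace false -- `Summit.PneNP.PneNP.…`: summit = sub-problem name (D-0017 single-conjunct layout)

namespace Summit.PneNP.PneNP.Theorems.ClusLayer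

open Finset
open Summit.PneNP.PneNP.Theorems.ClusSkew (codimY)

/-- `D(S) = Σ_{x ∈ S} dim_S(x)` with `dim_S(x) = n·m − codim_S(x)`, as an integer (p1's `dimSum`, verbatim). -/
noncomputable def dimSum {n : ℕ} (m : ℕ) (S : Finset (Fin n → Fin m → ZMod 2)) : ℤ :=
  ∑ x ∈ S, (((n * m : ℕ) : ℤ) - (codimY m S x : ℤ))

/-- The crux's inequality for one `(n, m, Y)` (so `UniversalCertAll = ∀ n m Y, UCIneq n m Y`; p1's `UCIneq`, verbatim). -/
def UCIneq (n m : ℕ) (Y : Finset (Fin n → Fin m → ZMod 2)) : Prop :=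
  ∑ y ∈ Y, ((n : ℤ) - (codimY m Y y : ℤ)) ≤ ∑ k : Fin n, (2 : ℤ) ^ m * ((Y.filter fun y => y k = 0).card : ℤ)

/-- `L` is a LAYER FAMILY for `(Y, k)`: every point `x̄` of `(𝔽₂^m)^n` lies in exactly as many members of `L` as there are
points of `Y` in the `k`-fibre over `x̄` (p1's `IsLayerFamily`, verbatim). -/
def IsLayerFamily {n : ℕ} (m : ℕ) (Y : Finset (Fin (n + 1) → Fin m → ZMod 2)) (k : Fin (n + 1))
    (L : List (Finset (Fin n → Fin m → ZMod 2))) : Prop :=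
  ∀ x : Fin n → Fin m → ZMod 2,
    (L.filter fun S => x ∈ S).length = (Y.filter fun y => Fin.removeNth k y = x).card

/-- The LAYER INEQUALITY for `(Y, k, L)`: `D(Y) ≤ Σ_{S∈L} D(S) + (m−1)|Y| + 2^m·#{y ∈ Y : y_k = 0}` (p1's `LayerIneq`, verbatim). -/
def LayerIneq {n : ℕ} (m : ℕ) (Y : Finset (Fin (n + 1) → Fin m → ZMod 2)) (k : Fin (n + 1))
    (L : List (Finset (Fin n → Fin m → ZMod 2))) : Prop :=
  dimSum m Y ≤ (L.map (dimSum m)).sum + ((m : ℤ) - 1) * (Y.card : ℤ) + (2 : ℤ) ^ m * ((Y.filter fun y => y k = 0).card : ℤ)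

/-- CONJECTURE (the load-bearing stub of the line): every finite `Y ⊆ (𝔽₂^m)^{n+1}` with `n + 1 ≥ 3` blocks has a block `k` and a
layer family satisfying the layer inequality (p1's `LayerLemmaFrom3`, verbatim; OPEN — census: true for EVERY `k` in all data). -/
def LayerLemmaFrom3 : Prop :=
  ∀ n m : ℕ, 2 ≤ n → ∀ Y : Finset (Fin (n + 1) → Fin m → ZMod 2),
    ∃ k : Fin (n + 1), ∃ L : List (Finset (Fin n → Fin m → ZMod 2)), IsLayerFamily m Y k L ∧ LayerIneq m Y k L

/-- BASE: the certificate for at most two blocks and every `m` (p1's `UCLeTwo`, verbatim; `n = 0, 1` are trivial, `n = 2` is the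
column-domination theorem of the line card §UC2). -/
def UCLeTwo : Prop :=
  ∀ n m : ℕ, n ≤ 2 → ∀ Y : Finset (Fin n → Fin m → ZMod 2), UCIneq n m Y

/-- BOOKKEEPING (the induction step): for a layer family, `Σ_{S∈L} |S| = |Y|` and `Σ_{S∈L} ZE(S) = ZE(Y) − Z_k(Y)`, so the `n`-block
certificates of the members plus the layer inequality give the certificate of `Y` (p1's `LayerStepAll`, verbatim). -/
def LayerStepAll : Prop :=
  ∀ n m : ℕ, ∀ Y : Finset (Fin (n + 1) → Fin m → ZMod 2), ∀ k : Fin (n + 1),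
    ∀ L : List (Finset (Fin n → Fin m → ZMod 2)),
      IsLayerFamily m Y k L → LayerIneq m Y k L → (∀ S ∈ L, UCIneq n m S) → UCIneq (n + 1) m Y

/-- Induction on the number of blocks from the three stub statements (base: at most two blocks) — the registered skeleton's
`ucIneq_all`, sorry-free: `UCLeTwo → LayerLemmaFrom3 → LayerStepAll → ∀ n m Y, UCIneq n m Y`. -/
theorem ucIneq_all (h₀ : UCLeTwo) (h₁ : LayerLemmaFrom3) (h₂ : LayerStepAll) :
    ∀ n m : ℕ, ∀ Y : Finset (Fin n → Fin m → ZMod 2), UCIneq n m Y := by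
  intro n
  induction n with
  | zero => intro m Y; exact h₀ 0 m (by omega) Y
  | succ n ih =>
    intro m Y
    by_cases hn : 2 ≤ n
    · obtain ⟨k, L, hfam, hineq⟩ := h₁ n m hn Y
      exact h₂ n m Y k L hfam hineq fun S _ => ih m S
    · exact h₀ (n + 1) m (by omega) Y

end Summit.PneNP.PneNP.Theorems.ClusLayer
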